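import Summits.CriticalPhenomena.Ising3DConformalLimit.Theorems.LeeYangGapNearCriticalLeeYangGapCubeGapFunnel
import Literature.Probability.LatticeModels.BoxTwoPointTransfer
import Literature.Probability.LatticeModels.GriffithsMonotonicity
import Literature.Probability.LatticeModels.IsingMonotonicity

/-!
# Near-critical Lee–Yang gap — anatomy of the open stub S1r `stub_firstZeroRate`

Route `LeeYangGap` (Ising3DConformalLimit), crux `NearCriticalLeeYangGap` (GAP, item
stmt-CriticalPhenomena-4945), line `registered`, lead c5. The line proves GAP from EDGE (item 4946,
`YangLeeEdgeHyperscaling`) and two open stubs, of which the hardest is the FIRST-ZERO RATE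

  (S1r)  `∃ A K₀ β₀, ∀ β ∈ [β₀,β_c), ∀ L ≥ K₀ξ(β), ∀ n, α₁(Λ_L,β) ≤ A·α₁(Λ_n,β)`

(`α₁(Λ,β) = JiangNewman.firstZero 3 Λ β`, first Lee–Yang zero of the FREE cube; `ξ = isingCorrLength 3`,
`χ = susceptibility 3`). This file records, kernel-checked, what S1r costs — it is not only a finite-size
statement ("the zeros of a cube of `K₀` correlation lengths have saturated") but carries a thermodynamic
hyperscaling inequality of its own:

* `two_le_sq_mul_isingExpect_sq_of_cos_eq_zero` — the elementary half of Newman's `t₁² ≥ 2`: a real zero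
  `t` of `⟨cos tX⟩` has `t²⟨X²⟩ ≥ 2` (`cos x ≥ 1 − x²/2`; no Lee–Yang property needed);
* `isingExpect_blockSq_le_card_mul_susceptibility` — `⟨M_Λ²⟩^free_{Λ;β,0} ≤ |Λ|·χ(β)` below `β_c`
  (Griffiths II in the volume, translation invariance, `χ < ∞` by sharpness);
* `reverseEdge_of_firstZeroRate` — **S1r ⟹ reverse edge hyperscaling**: there are `c > 0`, `β₁ < β_c`
  with `α₁(Λ_n,β)²·χ(β)·ξ(β)³ ≥ c` for ALL `n` and all `β ∈ [β₁,β_c)`; letting `n → ∞` (Jiang–Newman: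
  `α₁(Λ_n,β) ↓ θ_e(β)`, the Yang–Lee edge) this is `θ_e²χξ³ ≥ c`, the amplitude form of `2Δ ≤ γ + 3ν` —
  the REVERSE of the route's crux EDGE (`θ_e²χξ³ ≤ C`, `2Δ ≥ γ + 3ν`). So the composition EDGE + S1r uses
  full two-sided edge hyperscaling `θ_e(β)² ≍ (χξ³)⁻¹`;
* `cubeZero_sq_mul_le_of_edge_of_firstZeroRate`, `cubeZero_frozen_of_edge_of_firstZeroRate` —
  **EDGE + S1r ⟹ the ξ-cube zero is frozen at the edge scale**: `c ≤ α₁(Λ_L,β)²χξ³ ≤ C` for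
  `L ≥ K₀ξ(β)`;
* `cubeZero_sq_mul_variance_le_of_edge_of_firstZeroRate` — hence, for cubes of `K₀ … K₀+1`
  correlation lengths, `α₁(Λ_L,β)²·⟨M_L²⟩^free_{Λ_L;β} ≤ C'`: the first zero of the ξ-cube sits at the
  Newman scale `Var^{-1/2}`, i.e. (Newman 1975: `12/t₁⁴ ≤ |κ₄|/Var² ≤ 6/t₁²`) EDGE + S1r force
  NON-GAUSSIANITY OF THE FREE CUBE AT SCALE ξ(β), uniformly as `β ↑ β_c` — a finite-size twin of the
  crux itself (GAP ⟺ critical block Binder cumulant `↛ 0`).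

Conclusion for the planner (lead c5): the subcritical detour EDGE + S1r + S2χ₁ of line `registered`
requires two-sided edge hyperscaling, ξ-scale cube non-Gaussianity and (S2χ₁) the Fisher amplitude
relation, each an open `d = 3` statement, to produce the single critical statement (CG_c) of the
companion file `…CriticalCubeGap.lean`; promote (CG_c), not S1r/S2χ₁.

## References

* C. M. Newman, *Inequalities for Ising models and field theories which obey the Lee–Yang theorem*,
  CMP 41 (1975) 1–9, Thm 3 / eq. for `u₂`, `u₄` [Newman1975].
* J. Jiang, C. M. Newman, CPAM 77 (2024) 1224–1234, Thm 1 [JiangNewman2023].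
* C. Itzykson, R. B. Pearson, J. B. Zuber, Nucl. Phys. B220 (1983) 415–433 [ItzyksonPearsonZuber1983].
* S. Friedli, Y. Velenik, *Statistical Mechanics of Lattice Systems* (CUP 2017), §3.7.4, Exercise 3.12
  [FriedliVelenik2017]; M. Aizenman, D. Barsky, R. Fernández, JSP 47 (1987) [AizenmanBarskyFernandezJSP1987].
-/

noncomputable section

namespace Summit.CriticalPhenomena.Ising3DConformalLimit.LeeYangGapNearCriticalLeeYangGap

open Filter Finset
open Literature.Probability.LatticeModels
open Summit.CriticalPhenomena.Ising3DConformalLimit.Theses.LeeYangGap (YangLeeEdgeHyperscaling)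

/-! ### Two elementary inequalities -/

/-- **The elementary half of Newman's `t₁² ≥ 2`.** If `t` is a real zero of the finite-volume
characteristic function `⟨cos(t X)⟩^free_{Λ;β,0}` of a block spin `X = Σ_{x∈B} σ_x`, then
`2 ≤ t²·⟨X²⟩^free_{Λ;β,0}`: indeed `cos y ≥ 1 − y²/2` pointwise, so `0 = ⟨cos tX⟩ ≥ 1 − t²⟨X²⟩/2`.
(For Lee–Yang measures Newman's identity `⟨X²⟩ = 2Σ_j t_j⁻²` gives the same with all zeros.) -/
theorem two_le_sq_mul_isingExpect_sq_of_cos_eq_zero (Λ B : Finset (Site 3)) (β t : ℝ)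
    (h : isingExpect (zdGraph 3) Λ β 0 .free (fun σ => Real.cos (t * ∑ x ∈ B, spinAt x σ)) = 0) :
    2 ≤ t ^ 2 * isingExpect (zdGraph 3) Λ β 0 .free (fun σ => (∑ x ∈ B, spinAt x σ) ^ 2) := by
  have hM : Measurable fun σ : SpinConfig (Site 3) => ∑ x ∈ B, spinAt x σ :=
    Finset.measurable_sum _ fun x _ => measurable_spinAt x
  have hsq : Measurable fun σ : SpinConfig (Site 3) => (∑ x ∈ B, spinAt x σ) ^ 2 := hM.pow_const 2
  have hcos : Measurable fun σ : SpinConfig (Site 3) => Real.cos (t * ∑ x ∈ B, spinAt x σ) :=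
    Real.measurable_cos.comp (hM.const_mul _)
  have hlin : Measurable fun σ : SpinConfig (Site 3) =>
      (1 : ℝ) + (-(t ^ 2 / 2)) * (∑ x ∈ B, spinAt x σ) ^ 2 := measurable_const.add (hsq.const_mul _)
  -- `⟨1 − t²X²/2⟩ ≤ ⟨cos tX⟩ = 0`
  have hle := isingExpect_mono_fun (zdGraph 3) Λ β 0 .free hlin hcos fun σ => by
    have := Real.one_sub_sq_div_two_le_cos (x := t * ∑ x ∈ B, spinAt x σ)
    nlinarith [this]
  rw [h, isingExpect_add' (zdGraph 3) Λ 0 .free β measurable_const (hsq.const_mul _),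
    isingExpect_const_mul' (zdGraph 3) Λ 0 .free β _ hsq, isingExpect_const] at hle
  nlinarith [hle]

/-- **`⟨M_Λ²⟩^free_{Λ;β,0} ≤ |Λ|·χ(β)` for `0 ≤ β < β_c(3)`**: `M_Λ² = Σ_{x,y∈Λ} σ_xσ_y`,
`⟨σ_xσ_y⟩^free_{Λ;β,0} ≤ ⟨σ₀σ_{y−x}⟩^free_β` (Griffiths II in the volume and translation invariance,
`isingTwoPoint_box_le_twoPointFree`), and each row `Σ_{y∈Λ} ⟨σ₀σ_{y−x}⟩^free_β ≤ χ(β)` (`χ(β) < ∞` below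
`β_c` by Aizenman–Barsky–Fernández sharpness). -/
theorem isingExpect_blockSq_le_card_mul_susceptibility {β : ℝ} (hβ : 0 ≤ β) (hβc : β < criticalBeta 3)
    (Λ : Finset (Site 3)) :
    isingExpect (zdGraph 3) Λ β 0 .free (fun σ => (∑ x ∈ Λ, spinAt x σ) ^ 2) ≤
      (#Λ : ℝ) * (susceptibility 3 β).toReal := by
  have hχ : susceptibility 3 β ≠ ⊤ :=
    (susceptibility_lt_top_of_lt_criticalBeta (d := 3) (by norm_num) hβ hβc).ne
  -- expand the square and use linearity of the finite-volume expectation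
  have hexp : (fun σ : SpinConfig (Site 3) => (∑ x ∈ Λ, spinAt x σ) ^ 2) =
      fun σ => ∑ x ∈ Λ, ∑ y ∈ Λ, spinPair x y σ := by
    funext σ
    rw [sq, Finset.sum_mul_sum]
    rfl
  rw [hexp, isingExpect_finset_sum' (zdGraph 3) Λ 0 .free β Λ _
    (fun x => Finset.measurable_sum _ fun y _ => measurable_spinPair x y)]
  have hrow : ∀ x ∈ Λ, isingExpect (zdGraph 3) Λ β 0 .free (fun σ => ∑ y ∈ Λ, spinPair x y σ) ≤
      (susceptibility 3 β).toReal := by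
    intro x hx
    rw [isingExpect_finset_sum' (zdGraph 3) Λ 0 .free β Λ _ (fun y => measurable_spinPair x y)]
    calc ∑ y ∈ Λ, isingExpect (zdGraph 3) Λ β 0 .free (spinPair x y)
        ≤ ∑ y ∈ Λ, twoPointFree 3 β (y - x) :=
          Finset.sum_le_sum fun y hy => isingTwoPoint_box_le_twoPointFree hβ hx hy
      _ = ∑ z ∈ Λ.image (fun y => y - x), twoPointFree 3 β z := by
          rw [Finset.sum_image fun y _ y' _ h => sub_left_injective h]
      _ ≤ (susceptibility 3 β).toReal := sum_twoPointFree_le_susceptibility_toReal hβ hχ _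
  calc ∑ x ∈ Λ, isingExpect (zdGraph 3) Λ β 0 .free (fun σ => ∑ y ∈ Λ, spinPair x y σ)
      ≤ ∑ x ∈ Λ, (susceptibility 3 β).toReal := Finset.sum_le_sum hrow
    _ = (#Λ : ℝ) * (susceptibility 3 β).toReal := by rw [Finset.sum_const, nsmul_eq_mul]

/-- Cardinality of a cube of `⌈K₀ξ⌉` or slightly more sites, against `ξ³`: if `1 ≤ ξ` and
`L ≤ (K₀ + 1)ξ` then `|Λ_L| = (2L+1)³ ≤ (2K₀ + 3)³·ξ³` (as `2L + 1 ≤ 2(K₀+1)ξ + ξ`). -/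
theorem card_box_le_of_le_mul_corrLength {K₀ ξ : ℝ} {L : ℕ} (hξ1 : 1 ≤ ξ)
    (hL : (L : ℝ) ≤ (K₀ + 1) * ξ) :
    (#(box 3 L) : ℝ) ≤ (2 * K₀ + 3) ^ 3 * ξ ^ 3 := by
  rw [card_box]
  push_cast
  have h1 : (2 * (L : ℝ) + 1) ≤ (2 * K₀ + 3) * ξ := by nlinarith
  have h0 : (0 : ℝ) ≤ 2 * (L : ℝ) + 1 := by positivity
  calc (2 * (L : ℝ) + 1) ^ 3 ≤ ((2 * K₀ + 3) * ξ) ^ 3 := pow_le_pow_left₀ h0 h1 3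
    _ = (2 * K₀ + 3) ^ 3 * ξ ^ 3 := by ring

/-! ### S1r ⟹ reverse edge hyperscaling -/

/-- **S1r ⟹ reverse edge hyperscaling.** If the first Lee–Yang zero of every free cube of at least
`K₀` correlation lengths is within a factor `A` of that of EVERY other cube (the registered stub
`stub_firstZeroRate` of line `registered`, verbatim as hypothesis), then there are `c > 0` and
`β₁ < β_c(3)` such that `c ≤ α₁(Λ_n,β)²·χ(β)·ξ(β)³` for all `n` and all `β ∈ [β₁, β_c)`. Proof: with
`L := ⌈K₀ξ(β)⌉`, `2 ≤ α₁(Λ_L,β)²⟨M_L²⟩^free ≤ α₁(Λ_L,β)²|Λ_L|χ ≤ A²α₁(Λ_n,β)²(2K₀+3)³ξ³χ`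
(`two_le_sq_mul_isingExpect_sq_of_cos_eq_zero` at the cube zero `α₁(Λ_L,β)` of `stub_firstZeroAttained`,
`isingExpect_blockSq_le_card_mul_susceptibility`, S1r). In the limit `n → ∞` (`α₁(Λ_n,β) ↓ θ_e(β)`,
Jiang–Newman 2023 Thm 1) this reads `θ_e(β)²χ(β)ξ(β)³ ≥ c`: the amplitude form of `2Δ ≤ γ + 3ν`, the
reverse of the route's crux EDGE. -/
theorem reverseEdge_of_firstZeroRate
    (hR : ∃ A K₀ β₀ : ℝ, 0 < A ∧ 0 < K₀ ∧ β₀ < Literature.Probability.LatticeModels.criticalBeta 3 ∧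
      ∀ β : ℝ, β₀ ≤ β → β < Literature.Probability.LatticeModels.criticalBeta 3 → ∀ L : ℕ,
        K₀ * Literature.Probability.LatticeModels.isingCorrLength 3 β ≤ (L : ℝ) → ∀ n : ℕ,
          Literature.Probability.LatticeModels.JiangNewman.firstZero 3
              (Literature.Probability.LatticeModels.box 3 L) β ≤
            A * Literature.Probability.LatticeModels.JiangNewman.firstZero 3
              (Literature.Probability.LatticeModels.box 3 n) β) :
    ∃ c β₁ : ℝ, 0 < c ∧ β₁ < criticalBeta 3 ∧ ∀ β : ℝ, β₁ ≤ β → β < criticalBeta 3 → ∀ n : ℕ,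
      c ≤ JiangNewman.firstZero 3 (box 3 n) β ^ 2 * (susceptibility 3 β).toReal *
        isingCorrLength 3 β ^ 3 := by
  obtain ⟨A, K₀, β₀, hA, hK₀, hβ₀, hR⟩ := hR
  -- `ξ ≥ 1` on a left neighbourhood `[β₁, β_c)` of `β_c`, `β₁ ≥ β₀`, `β₁ > 0`
  obtain ⟨β₁, hβ₀β₁, hβ₁pos, hβ₁lt, hξ⟩ := eventually_le_isingCorrLength 1 β₀ hβ₀
  refine ⟨2 / (A ^ 2 * (2 * K₀ + 3) ^ 3), β₁, by positivity, hβ₁lt, fun β hβ₁β hββc n => ?_⟩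
  have hβpos : 0 < β := hβ₁pos.trans_le hβ₁β
  have hβ₀β : β₀ ≤ β := hβ₀β₁.trans hβ₁β
  have hξ1 : 1 ≤ isingCorrLength 3 β := hξ β hβ₁β hββc
  set ξ := isingCorrLength 3 β with hξdef
  set χ := (susceptibility 3 β).toReal with hχdef
  set L := ⌈K₀ * ξ⌉₊ with hLdef
  have hKξL : K₀ * ξ ≤ (L : ℝ) := Nat.le_ceil _
  have hLle : (L : ℝ) ≤ (K₀ + 1) * ξ := by
    have := (Nat.ceil_lt_add_one (by positivity : (0 : ℝ) ≤ K₀ * ξ)).le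
    rw [← hLdef] at this
    nlinarith
  -- the cube zero of `Λ_L` and the two elementary inequalities
  obtain ⟨hαpos, hαzero⟩ := stub_firstZeroAttained L β hβpos.le
  have h2 := two_le_sq_mul_isingExpect_sq_of_cos_eq_zero (box 3 L) (box 3 L) β _ hαzero
  have hVar := isingExpect_blockSq_le_card_mul_susceptibility hβpos.le hββc (box 3 L)
  have hcard := card_box_le_of_le_mul_corrLength hξ1 hLle
  have hχ0 : 0 ≤ χ := ENNReal.toReal_nonneg
  have hξ0 : 0 ≤ ξ := zero_le_one.trans hξ1
  -- S1r: `α₁(Λ_L) ≤ A α₁(Λ_n)`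
  have hrate := hR β hβ₀β hββc L hKξL n
  have hα0 : 0 ≤ JiangNewman.firstZero 3 (box 3 L) β := hαpos.le
  have hsq : JiangNewman.firstZero 3 (box 3 L) β ^ 2 ≤
      A ^ 2 * JiangNewman.firstZero 3 (box 3 n) β ^ 2 := by
    rw [← mul_pow]; exact pow_le_pow_left₀ hα0 hrate 2
  -- chain: `2 ≤ α_L²·Var ≤ α_L²·|Λ_L|·χ ≤ α_L²·(2K₀+3)³ξ³χ ≤ A²α_n²·(2K₀+3)³ξ³χ`
  have hstep1 : (2 : ℝ) ≤ JiangNewman.firstZero 3 (box 3 L) β ^ 2 * ((2 * K₀ + 3) ^ 3 * ξ ^ 3 * χ) := by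
    refine h2.trans (mul_le_mul_of_nonneg_left (hVar.trans ?_) (sq_nonneg _))
    exact mul_le_mul_of_nonneg_right hcard hχ0
  have hstep2 : JiangNewman.firstZero 3 (box 3 L) β ^ 2 * ((2 * K₀ + 3) ^ 3 * ξ ^ 3 * χ) ≤
      A ^ 2 * JiangNewman.firstZero 3 (box 3 n) β ^ 2 * ((2 * K₀ + 3) ^ 3 * ξ ^ 3 * χ) :=
    mul_le_mul_of_nonneg_right hsq (by positivity)
  have hkey : 2 ≤ A ^ 2 * (2 * K₀ + 3) ^ 3 *
      (JiangNewman.firstZero 3 (box 3 n) β ^ 2 * χ * ξ ^ 3) := by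
    have := hstep1.trans hstep2
    nlinarith [this]
  rw [div_le_iff₀ (by positivity : (0 : ℝ) < A ^ 2 * (2 * K₀ + 3) ^ 3)]
  linarith [hkey]

/-! ### EDGE + S1r ⟹ the ξ-cube zero is frozen at the edge scale -/

/-- **EDGE + S1r ⟹ `α₁(Λ_L,β)²χξ³ ≤ C` for `L ≥ K₀ξ(β)`.** S1r puts `α₁(Λ_L,β)/A` below every
`α₁(Λ_n,β)`; the landed S1e (`stub_edgeAnalyticity`) makes `m(β,·)` analytic on `{|Im h| < c·α₁(Λ_L,β)/A}`;
EDGE (route item 4946 `YangLeeEdgeHyperscaling`, by name) at that width gives `(cα₁/A)²χξ³ ≤ C₁`. -/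
theorem cubeZero_sq_mul_le_of_edge_of_firstZeroRate (hE : YangLeeEdgeHyperscaling)
    (hR : ∃ A K₀ β₀ : ℝ, 0 < A ∧ 0 < K₀ ∧ β₀ < Literature.Probability.LatticeModels.criticalBeta 3 ∧
      ∀ β : ℝ, β₀ ≤ β → β < Literature.Probability.LatticeModels.criticalBeta 3 → ∀ L : ℕ,
        K₀ * Literature.Probability.LatticeModels.isingCorrLength 3 β ≤ (L : ℝ) → ∀ n : ℕ,
          Literature.Probability.LatticeModels.JiangNewman.firstZero 3
              (Literature.Probability.LatticeModels.box 3 L) β ≤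
            A * Literature.Probability.LatticeModels.JiangNewman.firstZero 3
              (Literature.Probability.LatticeModels.box 3 n) β) :
    ∃ C K₀ β₁ : ℝ, 0 < K₀ ∧ β₁ < criticalBeta 3 ∧ ∀ β : ℝ, β₁ ≤ β → β < criticalBeta 3 →
      ∀ L : ℕ, K₀ * isingCorrLength 3 β ≤ (L : ℝ) →
        JiangNewman.firstZero 3 (box 3 L) β ^ 2 * (susceptibility 3 β).toReal *
          isingCorrLength 3 β ^ 3 ≤ C := by
  obtain ⟨C₁, β₀, hβ₀, hE⟩ := hE
  obtain ⟨A, K₀, β₀', hA, hK₀, hβ₀', hR⟩ := hR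
  obtain ⟨c, β₀'', hc, hβ₀'', hAn⟩ := stub_edgeAnalyticity
  have hβc : 0 < criticalBeta 3 := criticalBeta_pos_holds (d := 3) (by norm_num)
  refine ⟨(A / c) ^ 2 * C₁, K₀, max (max (max β₀ β₀') β₀'') (criticalBeta 3 / 2), hK₀,
    max_lt (max_lt (max_lt hβ₀ hβ₀') hβ₀'') (by linarith), fun β hβ₁β hββc L hKξL => ?_⟩
  have hm3 : max (max β₀ β₀') β₀'' ≤ β := le_trans (le_max_left _ _) hβ₁β
  have hm2 : max β₀ β₀' ≤ β := le_trans (le_max_left _ _) hm3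
  have hβ₀β : β₀ ≤ β := le_trans (le_max_left _ _) hm2
  have hβ₀'β : β₀' ≤ β := le_trans (le_max_right _ _) hm2
  have hβ₀''β : β₀'' ≤ β := le_trans (le_max_right _ _) hm3
  have hβpos : 0 < β := lt_of_lt_of_le (by linarith) (le_trans (le_max_right _ _) hβ₁β)
  obtain ⟨hαpos, -⟩ := stub_firstZeroAttained L β hβpos.le
  set α := JiangNewman.firstZero 3 (box 3 L) β with hαdef
  have hw : ∀ n : ℕ, α / A ≤ JiangNewman.firstZero 3 (box 3 n) β := fun n => by
    rw [div_le_iff₀ hA]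
    linarith [hR β hβ₀'β hββc L hKξL n]
  obtain ⟨F, hF, hFm⟩ := hAn β hβ₀''β hββc _ (div_pos hαpos hA) hw
  have hEdge := hE β (c * (α / A)) hβ₀β hββc (by positivity) ⟨F, hF, hFm⟩
  -- `α²χξ³ = (A/c)²·(cα/A)²χξ³ ≤ (A/c)²·C₁`
  have heq : α ^ 2 = (A / c) ^ 2 * (c * (α / A)) ^ 2 := by
    field_simp
  have hnn : 0 ≤ (susceptibility 3 β).toReal * isingCorrLength 3 β ^ 3 :=
    mul_nonneg ENNReal.toReal_nonneg
      (pow_nonneg (isingCorrLength_pos hβpos hββc).le 3)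
  calc α ^ 2 * (susceptibility 3 β).toReal * isingCorrLength 3 β ^ 3
      = (A / c) ^ 2 * ((c * (α / A)) ^ 2 * (susceptibility 3 β).toReal *
          isingCorrLength 3 β ^ 3) := by rw [heq]; ring
    _ ≤ (A / c) ^ 2 * C₁ := mul_le_mul_of_nonneg_left hEdge (sq_nonneg _)

/-- **EDGE + S1r ⟹ the ξ-cube zero is frozen: `c ≤ α₁(Λ_L,β)²χξ³ ≤ C` for `L ≥ K₀ξ(β)`** — the
two-sided statement (lower bound: `reverseEdge_of_firstZeroRate`, valid for every `L`; upper bound: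
`cubeZero_sq_mul_le_of_edge_of_firstZeroRate`). This is the finite-size Itzykson–Pearson–Zuber law
`α₁(Λ_{Kξ},β) ≍ θ_e(β) ≍ (χξ³)^{-1/2}` the line's hypotheses encode. -/
theorem cubeZero_frozen_of_edge_of_firstZeroRate (hE : YangLeeEdgeHyperscaling)
    (hR : ∃ A K₀ β₀ : ℝ, 0 < A ∧ 0 < K₀ ∧ β₀ < Literature.Probability.LatticeModels.criticalBeta 3 ∧
      ∀ β : ℝ, β₀ ≤ β → β < Literature.Probability.LatticeModels.criticalBeta 3 → ∀ L : ℕ,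
        K₀ * Literature.Probability.LatticeModels.isingCorrLength 3 β ≤ (L : ℝ) → ∀ n : ℕ,
          Literature.Probability.LatticeModels.JiangNewman.firstZero 3
              (Literature.Probability.LatticeModels.box 3 L) β ≤
            A * Literature.Probability.LatticeModels.JiangNewman.firstZero 3
              (Literature.Probability.LatticeModels.box 3 n) β) :
    ∃ c C K₀ β₁ : ℝ, 0 < c ∧ 0 < K₀ ∧ β₁ < criticalBeta 3 ∧ ∀ β : ℝ, β₁ ≤ β → β < criticalBeta 3 →
      ∀ L : ℕ, K₀ * isingCorrLength 3 β ≤ (L : ℝ) →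
        c ≤ JiangNewman.firstZero 3 (box 3 L) β ^ 2 * (susceptibility 3 β).toReal *
          isingCorrLength 3 β ^ 3 ∧
        JiangNewman.firstZero 3 (box 3 L) β ^ 2 * (susceptibility 3 β).toReal *
          isingCorrLength 3 β ^ 3 ≤ C := by
  obtain ⟨c, β₁, hc, hβ₁, hlow⟩ := reverseEdge_of_firstZeroRate hR
  obtain ⟨C, K₀, β₁', hK₀, hβ₁', hup⟩ := cubeZero_sq_mul_le_of_edge_of_firstZeroRate hE hR
  refine ⟨c, C, K₀, max β₁ β₁', hc, hK₀, max_lt hβ₁ hβ₁', fun β hβ hββc L hL => ⟨?_, ?_⟩⟩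
  · exact hlow β ((le_max_left _ _).trans hβ) hββc L
  · exact hup β ((le_max_right _ _).trans hβ) hββc L hL

/-- **EDGE + S1r ⟹ the first zero of the ξ-cube sits at the Newman scale `Var^{-1/2}`**: there are
`C, K₀, β₁` such that for `β ∈ [β₁,β_c)` and every cube with `K₀ξ(β) ≤ L ≤ (K₀+1)ξ(β)`,
`α₁(Λ_L,β)²·⟨M_L²⟩^free_{Λ_L;β,0} ≤ C` (`⟨M_L²⟩^free ≤ |Λ_L|χ ≤ (2K₀+3)³ξ³χ` and the frozen upper bound).
With the elementary `α₁²⟨M_L²⟩ ≥ 2` this pins `t₁ := α₁·Var^{1/2} ∈ [√2, √C]`; by Newman's inequalities for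
the Lee–Yang measure of the free cube (`12/t₁⁴ ≤ |κ₄(M_L)|/Var(M_L)² ≤ 6/t₁²`, Newman 1975) a bounded `t₁` is
exactly a Binder cumulant of the ξ-cube bounded away from `0`: the line's hypotheses force ξ-scale cube
non-Gaussianity uniformly as `β ↑ β_c`, the finite-size twin of the crux. -/
theorem cubeZero_sq_mul_variance_le_of_edge_of_firstZeroRate (hE : YangLeeEdgeHyperscaling)
    (hR : ∃ A K₀ β₀ : ℝ, 0 < A ∧ 0 < K₀ ∧ β₀ < Literature.Probability.LatticeModels.criticalBeta 3 ∧
      ∀ β : ℝ, β₀ ≤ β → β < Literature.Probability.LatticeModels.criticalBeta 3 → ∀ L : ℕ,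
        K₀ * Literature.Probability.LatticeModels.isingCorrLength 3 β ≤ (L : ℝ) → ∀ n : ℕ,
          Literature.Probability.LatticeModels.JiangNewman.firstZero 3
              (Literature.Probability.LatticeModels.box 3 L) β ≤
            A * Literature.Probability.LatticeModels.JiangNewman.firstZero 3
              (Literature.Probability.LatticeModels.box 3 n) β) :
    ∃ C K₀ β₁ : ℝ, 0 < K₀ ∧ β₁ < criticalBeta 3 ∧ ∀ β : ℝ, β₁ ≤ β → β < criticalBeta 3 →
      ∀ L : ℕ, K₀ * isingCorrLength 3 β ≤ (L : ℝ) → (L : ℝ) ≤ (K₀ + 1) * isingCorrLength 3 β →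
        JiangNewman.firstZero 3 (box 3 L) β ^ 2 *
          isingExpect (zdGraph 3) (box 3 L) β 0 .free (fun σ => (∑ x ∈ box 3 L, spinAt x σ) ^ 2) ≤
            C := by
  obtain ⟨C, K₀, β₁, hK₀, hβ₁, hup⟩ := cubeZero_sq_mul_le_of_edge_of_firstZeroRate hE hR
  obtain ⟨β₁', hβ₁β₁', hβ₁'pos, hβ₁'lt, hξ⟩ := eventually_le_isingCorrLength 1 β₁ hβ₁
  refine ⟨(2 * K₀ + 3) ^ 3 * C, K₀, β₁', hK₀, hβ₁'lt, fun β hβ hββc L hKL hLK => ?_⟩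
  have hβpos : 0 < β := hβ₁'pos.trans_le hβ
  have hξ1 : 1 ≤ isingCorrLength 3 β := hξ β hβ hββc
  have hVar := isingExpect_blockSq_le_card_mul_susceptibility hβpos.le hββc (box 3 L)
  have hcard := card_box_le_of_le_mul_corrLength hξ1 hLK
  have hχ0 : 0 ≤ (susceptibility 3 β).toReal := ENNReal.toReal_nonneg
  have hfrozen := hup β (hβ₁β₁'.trans hβ) hββc L hKL
  calc JiangNewman.firstZero 3 (box 3 L) β ^ 2 *
        isingExpect (zdGraph 3) (box 3 L) β 0 .free (fun σ => (∑ x ∈ box 3 L, spinAt x σ) ^ 2)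
      ≤ JiangNewman.firstZero 3 (box 3 L) β ^ 2 *
          ((2 * K₀ + 3) ^ 3 * isingCorrLength 3 β ^ 3 * (susceptibility 3 β).toReal) := by
        refine mul_le_mul_of_nonneg_left (hVar.trans ?_) (sq_nonneg _)
        exact mul_le_mul_of_nonneg_right hcard hχ0
    _ = (2 * K₀ + 3) ^ 3 * (JiangNewman.firstZero 3 (box 3 L) β ^ 2 * (susceptibility 3 β).toReal *
          isingCorrLength 3 β ^ 3) := by ring
    _ ≤ (2 * K₀ + 3) ^ 3 * C := mul_le_mul_of_nonneg_left hfrozen (by positivity)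

/-! ### Registered form -/

/-- **`stub_reverseEdgeOfFirstZeroRate` — S1r ⟹ reverse edge hyperscaling** (registered glue stub of
line `registered`, verbatim; the anatomy theorem `reverseEdge_of_firstZeroRate` with the registered open
stub `stub_firstZeroRate` as antecedent): uniformly in the volume `n` and in `β ∈ [β₁,β_c)`,
`c ≤ α₁(Λ_n,β)²·χ(β)·ξ(β)³`. -/
theorem stub_reverseEdgeOfFirstZeroRate :
    (∃ A K₀ β₀ : ℝ, 0 < A ∧ 0 < K₀ ∧ β₀ < Literature.Probability.LatticeModels.criticalBeta 3 ∧
      ∀ β : ℝ, β₀ ≤ β → β < Literature.Probability.LatticeModels.criticalBeta 3 → ∀ L : ℕ,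
        K₀ * Literature.Probability.LatticeModels.isingCorrLength 3 β ≤ (L : ℝ) → ∀ n : ℕ,
          Literature.Probability.LatticeModels.JiangNewman.firstZero 3
              (Literature.Probability.LatticeModels.box 3 L) β ≤
            A * Literature.Probability.LatticeModels.JiangNewman.firstZero 3
              (Literature.Probability.LatticeModels.box 3 n) β) →
    ∃ c β₁ : ℝ, 0 < c ∧ β₁ < Literature.Probability.LatticeModels.criticalBeta 3 ∧
      ∀ β : ℝ, β₁ ≤ β → β < Literature.Probability.LatticeModels.criticalBeta 3 → ∀ n : ℕ,
        c ≤ Literature.Probability.LatticeModels.JiangNewman.firstZero 3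
            (Literature.Probability.LatticeModels.box 3 n) β ^ 2 *
          (Literature.Probability.LatticeModels.susceptibility 3 β).toReal *
          Literature.Probability.LatticeModels.isingCorrLength 3 β ^ 3 :=
  reverseEdge_of_firstZeroRate

end Summit.CriticalPhenomena.Ising3DConformalLimit.LeeYangGapNearCriticalLeeYangGap

end
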